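import Summits.ResolutionOfSingularities.ResolutionOfSingularities.Theorems.RegularBlowupsDesingularization
import Summits.ResolutionOfSingularities.ResolutionOfSingularities.Theorems.ValuativePatchingRelFormatUpgrade
import Summits.ResolutionOfSingularities.ResolutionOfSingularities.Theorems.ValuativePatchingRelStrongBlowupToStrong
import Literature.AlgebraicGeometry.Resolution.BlowupSequences
import Literature.AlgebraicGeometry.Resolution.BlowupsComposition
import Literature.AlgebraicGeometry.Resolution.BlowupsIntegral
import Literature.AlgebraicGeometry.Resolution.AlterationsNormalizationReduction
import HarnessLib

/-!
# Crux `PatchingRel` (stmt-ResolutionOfSingularities-0642), line `sandwiched-gluing` (c2, wave 2):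
# Axiom 4 in blow-up format ↔ exceptional-admissible desingularization; SAND⁺ᵇ ↔ SAND⁺ ∧ Axiom 4

Two equivalences closing the one-way implications of cycle 1 of the line.

* (A1) `principalizationInChar_of_regularBlowupExcAdmissible` — **Piltant's Axiom 4 in blow-up
  format (`PrincipalizationInChar p`) IS exceptional-admissible desingularization of blowings up
  of regular varieties (`RegularBlowupExcAdmissibleResolution p`)**: the converse of c1's
  `regularBlowupExcAdmissibleResolution_of_principalization` (Stacks 080A read backwards). Given
  a regular variety `U` and `I ≠ 0`, blow up `I` (`η : Bl_I U → U`, the chosen blowing up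
  `blowup.π I`); exceptional admissibility provides `J ≠ 0` on `Bl_I U` with
  `V(J) ⊆ η⁻¹ V(I)` and `π : Bl_J (Bl_I U) → Bl_I U` with regular source. By Temkin 2008,
  Lemma 2.1.4 (`IsBlowup.exists_isBlowup_comp_supported`: a `T`-supported blowing up followed by
  a blowing up cosupported over `T` is ONE `T`-supported blowing up, `U` Noetherian) the composite
  `π ≫ η` is a blowing up of `U` along some `Q` with `V(Q) ⊆ V(I)`; and `I𝒪` is an effective
  Cartier divisor on its source because `I𝒪_{Bl_I U}` is one (definition of a blowing up) and
  effective Cartier divisors pull back along the dominant quasi-compact morphism `π` of integral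
  schemes (`IsEffectiveCartier.comap_of_isDominant`; `π` is a blowing up of the integral
  `Bl_I U` along `J ≠ 0`, hence birational and proper). Hence
  `principalizationInChar_iff_regularBlowupExcAdmissible`.
* (A2) `sandwichedStrongBlowup_iff_strong_and_principalization` — **the strong blow-up atom
  SAND⁺ᵇ(p) is EXACTLY the gen-0 strong atom SAND⁺(p) plus Axiom 4ᵇ(p)**:
  `SandwichedStrongBlowupResolution p ↔ SandwichedStrongResolution p ∧ PrincipalizationInChar p`.
  (→) B9 (`sandwichedStrongResolution_of_sandwichedStrongBlowup`) and SAND⁺ᵇ ⇒ Sing-admissible ⇒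
  Exc-admissible (c1) ⇒ Axiom 4ᵇ (A1); (←) the c1 format upgrade
  `sandwichedStrongBlowupResolution_of_strong_of_principalization`.

So the residual of the crux beyond local uniformization and Axiom 4 is literally the implication
`RegularBlowupExcAdmissibleResolution p → RegularBlowupSingAdmissibleResolution p` (the
exceptional-but-regular points: Zariski's bad points, Piltant 2013, Def. 5.4), which this file
does NOT claim. The registered universe-`0` stubs A1, A2 are the one-line specialisations.

## References

* O. Piltant, *An axiomatic version of Zariski's patching theorem*, RACSAM 107 (2013) 91–121,
  §2 Axiom 4; Def. 5.4 (bad points). [Piltant2013]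
* M. Temkin, *Desingularization of quasi-excellent schemes in characteristic zero*, Adv. Math.
  219 (2008), Lemma 2.1.4. [Temkin2008]
* The Stacks Project, Tag 080A (blowing up in a product of ideals), Tag 02ND. [StacksProject]
-/

-- `Summit.<Summit>.<Sub>.Theorems` with `Sub = Summit` (single-conjunct summit, D-0017): the
-- duplicated namespace component is the tree layout.
set_option linter.dupNamespace false

noncomputable section

namespace Summit.ResolutionOfSingularities.ResolutionOfSingularities.Theorems

open CategoryTheory AlgebraicGeometry TopologicalSpace
open Literature.AlgebraicGeometry.Resolution
open Summit.ResolutionOfSingularities.ResolutionOfSingularities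

universe u

/-- **Exceptional-admissible desingularization of blowings up of regular varieties ⇒ Axiom 4 in
blow-up format**: `RegularBlowupExcAdmissibleResolution p → PrincipalizationInChar p`. For a
regular variety `U` and `I ≠ 0`, an Exc-admissible regular blowing up `π : Bl_J (Bl_I U) → Bl_I U`
(`J ≠ 0`, `V(J) ⊆ η⁻¹ V(I)`) composed with `η : Bl_I U → U` is ONE `V(I)`-supported blowing up
of the Noetherian `U` (Temkin 2008, Lemma 2.1.4) with regular source, and it principalizes `I`:
`I𝒪_{Bl_I U}` is an effective Cartier divisor, and stays one after pull-back along the dominant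
quasi-compact morphism `π` of integral schemes (a blowing up of the integral `Bl_I U` along the
non-zero `J` is birational, hence dominant, and proper). [cite: Temkin2008, Lemma 2.1.4]
[cite: Piltant2013, §2 Axiom 4] [cite: StacksProject, Tag 02ND] -/
theorem principalizationInChar_of_regularBlowupExcAdmissible {p : ℕ}
    (h : RegularBlowupExcAdmissibleResolution.{u} p) : PrincipalizationInChar.{u} p := by
  intro k _ _ U f hf₁ hf₂ hf₃ hU hUreg I hI
  haveI := hf₁; haveI := hf₂; haveI := hf₃; haveI := hU
  -- `U` is Noetherian (of finite type over a field)
  haveI : IsLocallyNoetherian U := LocallyOfFiniteType.isLocallyNoetherian f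
  haveI : CompactSpace U := QuasiCompact.compactSpace_of_compactSpace f
  haveI : IsNoetherian U := {}
  -- the blowing up `η : Bl_I U → U` and its Exc-admissible desingularization `π`
  let η : blowup I ⟶ U := blowup.π I
  have hη : IsBlowup η I := blowup.isBlowup I
  obtain ⟨J, V', π, hJ, hJexc, hπ, hreg⟩ := h k U (blowup I) f η I hf₁ hf₂ hf₃ hU hUreg hI hη
  -- Temkin 2.1.4: `π ≫ η` is ONE `V(I)`-supported blowing up of `U`
  obtain ⟨Q, hQ, hQT⟩ :=
    hη.exists_isBlowup_comp_supported η I π J (I.support : Set U) subset_rfl hπ hJexc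
  refine ⟨Q, V', π ≫ η, hQT, hQ, hreg, ?_⟩
  -- `I𝒪_{V'}` is an effective Cartier divisor: pull back `I𝒪_{Bl_I U}` along the dominant `π`
  haveI : IsIntegral (blowup I) := hη.isIntegral hI
  haveI : IsIntegral V' := hπ.isIntegral hJ
  haveI : IsDominant π := (hπ.isBirational' hJ).isDominant
  haveI : IsProper η := hη.isProper
  haveI : IsLocallyNoetherian (blowup I) := LocallyOfFiniteType.isLocallyNoetherian (η ≫ f)
  haveI : IsProper π := hπ.isProper
  rw [Scheme.IdealSheafData.comap_comp]
  exact hη.isEffectiveCartier.comap_of_isDominant π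

/-- **Axiom 4 in blow-up format ↔ exceptional-admissible desingularization of blowings up of
regular varieties**: `PrincipalizationInChar p ↔ RegularBlowupExcAdmissibleResolution p`
(→ is c1's `regularBlowupExcAdmissibleResolution_of_principalization`, Stacks 080A read
backwards; ← is `principalizationInChar_of_regularBlowupExcAdmissible`, Temkin 2008,
Lemma 2.1.4). [cite: StacksProject, Tag 080A] [cite: Temkin2008, Lemma 2.1.4] -/
theorem principalizationInChar_iff_regularBlowupExcAdmissible {p : ℕ} :
    PrincipalizationInChar.{u} p ↔ RegularBlowupExcAdmissibleResolution.{u} p :=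
  ⟨regularBlowupExcAdmissibleResolution_of_principalization,
    principalizationInChar_of_regularBlowupExcAdmissible⟩

/-- **SAND⁺ᵇ(p) ↔ SAND⁺(p) ∧ Axiom 4ᵇ(p): the strong blow-up atom is exactly the gen-0 strong
atom plus Piltant's Axiom 4 in blow-up format.** (→) a Sing-admissible regular blowing up of a
sandwiched variety is a strong resolution (B9,
`sandwichedStrongResolution_of_sandwichedStrongBlowup`), and SAND⁺ᵇ restricted to the blowings
up `Bl_I U` of regular varieties is Sing-admissible, hence exceptional-admissible
desingularization, hence Axiom 4ᵇ (`principalizationInChar_of_regularBlowupExcAdmissible`);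
(←) the format upgrade `sandwichedStrongBlowupResolution_of_strong_of_principalization`
(Raynaud–Gruson `U`-admissible domination, Stacks 080A backwards, Temkin 2.1.4).
[cite: Piltant2013, §2 Axiom 4 and Def. 5.4] [cite: Temkin2008, Lemma 2.1.4]
[cite: StacksProject, Tag 081T] -/
theorem sandwichedStrongBlowup_iff_strong_and_principalization {p : ℕ} :
    SandwichedStrongBlowupResolution.{u} p ↔
      (SandwichedStrongResolution.{u} p ∧ PrincipalizationInChar.{u} p) :=
  ⟨fun h => ⟨sandwichedStrongResolution_of_sandwichedStrongBlowup h,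
    principalizationInChar_of_regularBlowupExcAdmissible
      (regularBlowupExcAdmissibleResolution_of_singAdmissible
        (regularBlowupSingAdmissibleResolution_of_sandwichedStrongBlowup h))⟩,
    fun h => sandwichedStrongBlowupResolution_of_strong_of_principalization h.1 h.2⟩

/-- **Registered stub A1 of line `sandwiched-gluing` (c2, wave 2)** (crux
stmt-ResolutionOfSingularities-0642, universe `0`): exceptional-admissible desingularization of
blowings up of regular varieties gives Piltant's Axiom 4 in blow-up format — the composite of the
two blowings up is one `V(I)`-supported blowing up with regular source principalizing `I`.
[cite: Temkin2008, Lemma 2.1.4] [cite: Piltant2013, §2 Axiom 4] -/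
theorem stub_principalization_of_regularBlowupExcAdmissible :
    ∀ p : ℕ, RegularBlowupExcAdmissibleResolution.{0} p → PrincipalizationInChar.{0} p :=
  fun _ h => principalizationInChar_of_regularBlowupExcAdmissible h

/-- **Registered stub A2 of line `sandwiched-gluing` (c2, wave 2)** (crux
stmt-ResolutionOfSingularities-0642, universe `0`): `SAND⁺ᵇ(p) ↔ SAND⁺(p) ∧ Axiom 4ᵇ(p)`, so
the crux's residual beyond LU and Axiom 4 is literally
`RegularBlowupExcAdmissibleResolution p → RegularBlowupSingAdmissibleResolution p`.
[cite: Piltant2013, §2 Axiom 4 and Def. 5.4] -/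
theorem stub_sandwichedStrongBlowup_iff_strong_and_principalization :
    ∀ p : ℕ, SandwichedStrongBlowupResolution.{0} p ↔
      (SandwichedStrongResolution.{0} p ∧ PrincipalizationInChar.{0} p) :=
  fun _ => sandwichedStrongBlowup_iff_strong_and_principalization

end Summit.ResolutionOfSingularities.ResolutionOfSingularities.Theorems

end
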